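import Summits.CriticalPhenomena.SAWScalingLimit.Theorems.SAWCircleScreeningScreeningRecursionTV
import HarnessLib

/-!
# Screening recursion for `SAWCircleScreening`, part IIb: the abstract one-scale step, assembled

Route `SAWCircleScreening` of `CriticalPhenomena/SAWScalingLimit`, support item
`ScreeningRecursion` (stmt-CriticalPhenomena-5468). Continuation of part II
(`SAWCircleScreeningScreeningRecursionTV`): the abstract coupling step `abstract_step`
(`|p(Φ ∈ A) - p'(Φ' ∈ A)| ≤ 4η + (1 - c₁ + 4η) d`, from proxy/true screens agreeing off a bad
event of mass `≤ η`, an exact screen with common kernel, `d`-close Markov kernels and screen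
overlap `≥ c₁`) and the solution of the resulting recurrence across scales (`recurrence_bound`).
Garban–Pete–Schramm 2013, §3 (proof of Prop. 11) is the model; everything here is elementary
algebra of finite sums.
-/

open Finset

namespace Summit.CriticalPhenomena.SAWScalingLimit.Theorems.ScreeningRecursion.Abstract

variable {X S : Type*} [Fintype X] [DecidableEq S]

/-- **The abstract one-scale coupling step** (see the module docstring). All "laws" are finite
probability vectors; events are predicates; conditional laws enter only through the two
integrated identities `hscreen` (exact screen, common kernel `q`) and `hmarkov` (Markov kernels
`μ`, `ν`, pairwise `d`-close). [folklore] -/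
theorem abstract_step {X' Z : Type*} [Fintype X']
    (p : X → ℝ) (p' : X' → ℝ) (hp : ∀ x, 0 ≤ p x) (hp' : ∀ x, 0 ≤ p' x)
    (hp1 : ∑ x, p x = 1) (hp1' : ∑ x, p' x = 1)
    (Φ : X → Z) (Φ' : X' → Z) (sc s : X → Option S) (sc' s' : X' → Option S)
    (R : X → Prop) (R' : X' → Prop) [DecidablePred R] [DecidablePred R']
    {η : ℝ} (hR : ∑ x ∈ univ.filter R, p x ≤ η) (hR' : ∑ x ∈ univ.filter R', p' x ≤ η)
    (hsc : ∀ x, ¬ R x → sc x = s x) (hsc' : ∀ x, ¬ R' x → sc' x = s' x)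
    (V : Finset S) (hVsc : ∀ x v, sc x = some v → v ∈ V)
    (hVsc' : ∀ x v, sc' x = some v → v ∈ V)
    (q : S → Set Z → ℝ) (hq0 : ∀ v A, 0 ≤ q v A) (hq1 : ∀ v A, q v A ≤ 1)
    (hscreen : ∀ (g : Option S → ℝ) (A : Set Z) [DecidablePred (· ∈ A)], g none = 0 →
      ∑ x, p x * g (s x) * (if Φ x ∈ A then 1 else 0) =
        ∑ x, p x * g (s x) * (s x).elim 0 (fun v => q v A))
    (hscreen' : ∀ (g : Option S → ℝ) (A : Set Z) [DecidablePred (· ∈ A)], g none = 0 →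
      ∑ x, p' x * g (s' x) * (if Φ' x ∈ A then 1 else 0) =
        ∑ x, p' x * g (s' x) * (s' x).elim 0 (fun v => q v A))
    (μ : X → Set Z → ℝ) (ν : X' → Set Z → ℝ)
    (hmarkov : ∀ (g : Option S → ℝ) (A : Set Z) [DecidablePred (· ∈ A)],
      ∑ x, p x * g (sc x) * (if Φ x ∈ A then 1 else 0) = ∑ x, p x * g (sc x) * μ x A)
    (hmarkov' : ∀ (g : Option S → ℝ) (A : Set Z) [DecidablePred (· ∈ A)],
      ∑ x, p' x * g (sc' x) * (if Φ' x ∈ A then 1 else 0) = ∑ x, p' x * g (sc' x) * ν x A)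
    {d : ℝ} (hd0 : 0 ≤ d)
    (hd : ∀ x x' A, 0 < p x → 0 < p' x' → |μ x A - ν x' A| ≤ d)
    {c₁ : ℝ} (hc : c₁ ≤ ∑ v ∈ V, min ((∑ x ∈ univ.filter (fun x => s x = some v), p x)) ((∑ x ∈ univ.filter (fun x => s' x = some v), p' x)))
    (A : Set Z) [DecidablePred (· ∈ A)] :
    |∑ x, p x * (if Φ x ∈ A then 1 else 0) - ∑ x, p' x * (if Φ' x ∈ A then 1 else 0)| ≤
      4 * η + (1 - c₁ + 4 * η) * d := by
  classical
  -- fibre masses of the proxies and their overlap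
  set π : S → ℝ := fun v => ∑ x ∈ univ.filter (fun x => sc x = some v), p x with hπ
  set π' : S → ℝ := fun v => ∑ x ∈ univ.filter (fun x => sc' x = some v), p' x with hπ'
  have hπ0 : ∀ v, 0 ≤ π v := fun v => fiberMass_nonneg hp sc v
  have hπ0' : ∀ v, 0 ≤ π' v := fun v => fiberMass_nonneg hp' sc' v
  set m : S → ℝ := fun v => min (π v) (π' v) with hm
  have hm0 : ∀ v, 0 ≤ m v := fun v => le_min (hπ0 v) (hπ0' v)
  -- the retained fractions `θ`, `θ'` (functions of the screen value, `0` at `none`)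
  set θ : Option S → ℝ := fun o => o.elim 0 (fun v => if π v = 0 then 0 else m v / π v) with hθ
  set θ' : Option S → ℝ := fun o => o.elim 0 (fun v => if π' v = 0 then 0 else m v / π' v) with hθ'
  have hθnone : θ none = 0 := rfl
  have hθnone' : θ' none = 0 := rfl
  have hθ01 : ∀ o, 0 ≤ θ o ∧ θ o ≤ 1 := by
    rintro (_ | v)
    · exact ⟨le_rfl, zero_le_one⟩
    · simp only [hθ, Option.elim_some]
      split_ifs with h
      · exact ⟨le_rfl, zero_le_one⟩
      · have hpos : 0 < π v := lt_of_le_of_ne (hπ0 v) (Ne.symm h)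
        exact ⟨div_nonneg (hm0 v) hpos.le, (div_le_one hpos).2 (min_le_left _ _)⟩
  have hθ01' : ∀ o, 0 ≤ θ' o ∧ θ' o ≤ 1 := by
    rintro (_ | v)
    · exact ⟨le_rfl, zero_le_one⟩
    · simp only [hθ', Option.elim_some]
      split_ifs with h
      · exact ⟨le_rfl, zero_le_one⟩
      · have hpos : 0 < π' v := lt_of_le_of_ne (hπ0' v) (Ne.symm h)
        exact ⟨div_nonneg (hm0 v) hpos.le, (div_le_one hpos).2 (min_le_right _ _)⟩
  have hπθ : ∀ v, π v * θ (some v) = m v := by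
    intro v
    simp only [hθ, Option.elim_some]
    split_ifs with h
    · have : m v = 0 := by
        apply le_antisymm _ (hm0 v)
        calc m v ≤ π v := min_le_left _ _
          _ = 0 := h
      rw [this, mul_zero]
    · field_simp
  have hπθ' : ∀ v, π' v * θ' (some v) = m v := by
    intro v
    simp only [hθ', Option.elim_some]
    split_ifs with h
    · have : m v = 0 := by
        apply le_antisymm _ (hm0 v)
        calc m v ≤ π' v := min_le_right _ _
          _ = 0 := h
      rw [this, mul_zero]
    · field_simp
  -- indicator of `A`
  set χ : X → ℝ := fun x => if Φ x ∈ A then 1 else 0 with hχ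
  set χ' : X' → ℝ := fun x => if Φ' x ∈ A then 1 else 0 with hχ'
  have hχ01 : ∀ x, 0 ≤ χ x ∧ χ x ≤ 1 := fun x => by
    simp only [hχ]; split_ifs <;> simp
  have hχ01' : ∀ x, 0 ≤ χ' x ∧ χ' x ≤ 1 := fun x => by
    simp only [hχ']; split_ifs <;> simp
  -- decomposition `P(Φ ∈ A) = L + T`
  set L : ℝ := ∑ x, p x * (1 - θ (sc x)) * μ x A with hL
  set L' : ℝ := ∑ x, p' x * (1 - θ' (sc' x)) * ν x A with hL'
  set T : ℝ := ∑ x, p x * θ (sc x) * χ x with hT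
  set T' : ℝ := ∑ x, p' x * θ' (sc' x) * χ' x with hT'
  have hdec : ∑ x, p x * χ x = L + T := by
    rw [hL, ← hmarkov (fun o => 1 - θ o) A, hT, ← sum_add_distrib]
    refine sum_congr rfl fun x _ => ?_; ring
  have hdec' : ∑ x, p' x * χ' x = L' + T' := by
    rw [hL', ← hmarkov' (fun o => 1 - θ' o) A, hT', ← sum_add_distrib]
    refine sum_congr rfl fun x _ => ?_; ring
  -- `T ≈ T*` (true screen) within `η`
  set Ts : ℝ := ∑ x, p x * θ (s x) * χ x with hTs
  set Ts' : ℝ := ∑ x, p' x * θ' (s' x) * χ' x with hTs'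
  have hTTs : |T - Ts| ≤ η := by
    have e : T - Ts = ∑ x, p x * ((θ (sc x) - θ (s x)) * χ x) := by
      rw [hT, hTs, ← sum_sub_distrib]; refine sum_congr rfl fun x _ => ?_; ring
    rw [e]
    refine sum_le_of_support_bad hp R hR _ (fun x hx => by rw [hsc x hx, sub_self, zero_mul]) ?_
    intro x
    rw [abs_mul]
    have h1 : |θ (sc x) - θ (s x)| ≤ 1 := by
      rw [abs_sub_le_iff]
      constructor <;> linarith [(hθ01 (sc x)).1, (hθ01 (sc x)).2, (hθ01 (s x)).1, (hθ01 (s x)).2]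
    have h2 : |χ x| ≤ 1 := by rw [abs_of_nonneg (hχ01 x).1]; exact (hχ01 x).2
    calc |θ (sc x) - θ (s x)| * |χ x| ≤ 1 * 1 := by gcongr
      _ = 1 := one_mul _
  have hTTs' : |T' - Ts'| ≤ η := by
    have e : T' - Ts' = ∑ x, p' x * ((θ' (sc' x) - θ' (s' x)) * χ' x) := by
      rw [hT', hTs', ← sum_sub_distrib]; refine sum_congr rfl fun x _ => ?_; ring
    rw [e]
    refine sum_le_of_support_bad hp' R' hR' _ (fun x hx => by rw [hsc' x hx, sub_self, zero_mul]) ?_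
    intro x
    rw [abs_mul]
    have h1 : |θ' (sc' x) - θ' (s' x)| ≤ 1 := by
      rw [abs_sub_le_iff]
      constructor <;>
        linarith [(hθ01' (sc' x)).1, (hθ01' (sc' x)).2, (hθ01' (s' x)).1, (hθ01' (s' x)).2]
    have h2 : |χ' x| ≤ 1 := by rw [abs_of_nonneg (hχ01' x).1]; exact (hχ01' x).2
    calc |θ' (sc' x) - θ' (s' x)| * |χ' x| ≤ 1 * 1 := by gcongr
      _ = 1 := one_mul _
  -- exact screen: `T* = ∑ p θ(s) q(s)`, then back to the proxy (`CORE`) within `η`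
  set Q : Option S → ℝ := fun o => o.elim 0 (fun v => q v A) with hQ
  have hQ01 : ∀ o, 0 ≤ Q o ∧ Q o ≤ 1 := by
    rintro (_ | v)
    · exact ⟨le_rfl, zero_le_one⟩
    · exact ⟨hq0 v A, hq1 v A⟩
  have hTsq : Ts = ∑ x, p x * θ (s x) * Q (s x) := by
    rw [hTs]; exact hscreen θ A hθnone
  have hTsq' : Ts' = ∑ x, p' x * θ' (s' x) * Q (s' x) := by
    rw [hTs']; exact hscreen' θ' A hθnone'
  set C : ℝ := ∑ x, p x * θ (sc x) * Q (sc x) with hC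
  set C' : ℝ := ∑ x, p' x * θ' (sc' x) * Q (sc' x) with hC'
  have hθQ1 : ∀ o o', |θ o * Q o - θ o' * Q o'| ≤ 1 := by
    intro o o'
    have a1 : 0 ≤ θ o * Q o := mul_nonneg (hθ01 o).1 (hQ01 o).1
    have a2 : θ o * Q o ≤ 1 := by
      calc θ o * Q o ≤ 1 * 1 := by gcongr; exacts [(hQ01 o).1, (hθ01 o).2, (hQ01 o).2]
        _ = 1 := one_mul _
    have b1 : 0 ≤ θ o' * Q o' := mul_nonneg (hθ01 o').1 (hQ01 o').1
    have b2 : θ o' * Q o' ≤ 1 := by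
      calc θ o' * Q o' ≤ 1 * 1 := by gcongr; exacts [(hQ01 o').1, (hθ01 o').2, (hQ01 o').2]
        _ = 1 := one_mul _
    rw [abs_sub_le_iff]; constructor <;> linarith
  have hθQ1' : ∀ o o', |θ' o * Q o - θ' o' * Q o'| ≤ 1 := by
    intro o o'
    have a1 : 0 ≤ θ' o * Q o := mul_nonneg (hθ01' o).1 (hQ01 o).1
    have a2 : θ' o * Q o ≤ 1 := by
      calc θ' o * Q o ≤ 1 * 1 := by gcongr; exacts [(hQ01 o).1, (hθ01' o).2, (hQ01 o).2]
        _ = 1 := one_mul _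
    have b1 : 0 ≤ θ' o' * Q o' := mul_nonneg (hθ01' o').1 (hQ01 o').1
    have b2 : θ' o' * Q o' ≤ 1 := by
      calc θ' o' * Q o' ≤ 1 * 1 := by gcongr; exacts [(hQ01 o').1, (hθ01' o').2, (hQ01 o').2]
        _ = 1 := one_mul _
    rw [abs_sub_le_iff]; constructor <;> linarith
  have hTsC : |Ts - C| ≤ η := by
    have e : Ts - C = ∑ x, p x * (θ (s x) * Q (s x) - θ (sc x) * Q (sc x)) := by
      rw [hTsq, hC, ← sum_sub_distrib]; refine sum_congr rfl fun x _ => ?_; ring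
    rw [e]
    exact sum_le_of_support_bad hp R hR _ (fun x hx => by rw [hsc x hx, sub_self])
      (fun x => hθQ1 _ _)
  have hTsC' : |Ts' - C'| ≤ η := by
    have e : Ts' - C' = ∑ x, p' x * (θ' (s' x) * Q (s' x) - θ' (sc' x) * Q (sc' x)) := by
      rw [hTsq', hC', ← sum_sub_distrib]; refine sum_congr rfl fun x _ => ?_; ring
    rw [e]
    exact sum_le_of_support_bad hp' R' hR' _ (fun x hx => by rw [hsc' x hx, sub_self])
      (fun x => hθQ1' _ _)
  -- `CORE = CORE'` (both equal `∑_v m v · q v A`)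
  have hCC' : C = C' := by
    have e1 : C = ∑ v ∈ V, m v * q v A := by
      rw [hC]
      have := sum_mul_apply_eq_sum_fiberMass p sc V hVsc (fun o => θ o * Q o) (by simp [hθnone])
      rw [show (∑ x, p x * θ (sc x) * Q (sc x)) = ∑ x, p x * (θ (sc x) * Q (sc x)) from
        sum_congr rfl fun x _ => by ring, this]
      refine sum_congr rfl fun v _ => ?_
      rw [← hπθ v]
      simp only [hQ, hπ, Option.elim_some]
      ring
    have e2 : C' = ∑ v ∈ V, m v * q v A := by
      rw [hC']
      have := sum_mul_apply_eq_sum_fiberMass p' sc' V hVsc' (fun o => θ' o * Q o) (by simp [hθnone'])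
      rw [show (∑ x, p' x * θ' (sc' x) * Q (sc' x)) = ∑ x, p' x * (θ' (sc' x) * Q (sc' x)) from
        sum_congr rfl fun x _ => by ring, this]
      refine sum_congr rfl fun v _ => ?_
      rw [← hπθ' v]
      simp only [hQ, hπ', Option.elim_some]
      ring
    rw [e1, e2]
  -- the leftover masses
  set qL : ℝ := ∑ x, p x * (1 - θ (sc x)) with hqL
  have hsumθ : ∑ x, p x * θ (sc x) = ∑ v ∈ V, m v := by
    rw [sum_mul_apply_eq_sum_fiberMass p sc V hVsc θ hθnone]
    exact sum_congr rfl fun v _ => hπθ v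
  have hsumθ' : ∑ x, p' x * θ' (sc' x) = ∑ v ∈ V, m v := by
    rw [sum_mul_apply_eq_sum_fiberMass p' sc' V hVsc' θ' hθnone']
    exact sum_congr rfl fun v _ => hπθ' v
  have hqL1 : qL = 1 - ∑ v ∈ V, m v := by
    rw [hqL, ← hsumθ]
    have : ∑ x, p x * (1 - θ (sc x)) = ∑ x, p x - ∑ x, p x * θ (sc x) := by
      rw [← sum_sub_distrib]; exact sum_congr rfl fun x _ => by ring
    rw [this, hp1]
  have hqL1' : ∑ x, p' x * (1 - θ' (sc' x)) = qL := by
    rw [hqL1, ← hsumθ']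
    have : ∑ x, p' x * (1 - θ' (sc' x)) = ∑ x, p' x - ∑ x, p' x * θ' (sc' x) := by
      rw [← sum_sub_distrib]; exact sum_congr rfl fun x _ => by ring
    rw [this, hp1']
  have hLL' : |L - L'| ≤ qL * d := by
    rw [hL, hL']
    refine abs_sum_mul_sub_sum_mul_le (fun x => p x * (1 - θ (sc x)))
      (fun x => p' x * (1 - θ' (sc' x))) (fun x => μ x A) (fun x => ν x A)
      (fun x => mul_nonneg (hp x) (by linarith [(hθ01 (sc x)).2]))
      (fun x => mul_nonneg (hp' x) (by linarith [(hθ01' (sc' x)).2])) rfl hqL1' ?_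
    intro x x' hx hx'
    have hpx : 0 < p x := by
      by_contra h
      have : p x = 0 := le_antisymm (not_lt.1 h) (hp x)
      rw [this, zero_mul] at hx
      exact lt_irrefl _ hx
    have hpx' : 0 < p' x' := by
      by_contra h
      have : p' x' = 0 := le_antisymm (not_lt.1 h) (hp' x')
      rw [this, zero_mul] at hx'
      exact lt_irrefl _ hx'
    exact hd x x' A hpx hpx'
  -- the overlap bound on the leftover mass
  have hqLle : qL ≤ 1 - c₁ + 4 * η := by
    have h1 : ∑ v ∈ V, min ((∑ x ∈ univ.filter (fun x => s x = some v), p x)) ((∑ x ∈ univ.filter (fun x => s' x = some v), p' x)) ≤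
        ∑ v ∈ V, m v + ∑ v ∈ V, |(∑ x ∈ univ.filter (fun x => sc x = some v), p x) - (∑ x ∈ univ.filter (fun x => s x = some v), p x)| +
          ∑ v ∈ V, |(∑ x ∈ univ.filter (fun x => sc' x = some v), p' x) - (∑ x ∈ univ.filter (fun x => s' x = some v), p' x)| := by
      rw [← sum_add_distrib, ← sum_add_distrib]
      refine sum_le_sum fun v _ => ?_
      have e1 := abs_sub_le_iff.1 (le_refl |(∑ x ∈ univ.filter (fun x => sc x = some v), p x) - (∑ x ∈ univ.filter (fun x => s x = some v), p x)|)
      have e2 := abs_sub_le_iff.1 (le_refl |(∑ x ∈ univ.filter (fun x => sc' x = some v), p' x) - (∑ x ∈ univ.filter (fun x => s' x = some v), p' x)|)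
      simp only [hm, hπ, hπ']
      rcases le_total ((∑ x ∈ univ.filter (fun x => sc x = some v), p x)) ((∑ x ∈ univ.filter (fun x => sc' x = some v), p' x)) with h | h
      · rw [min_eq_left h]
        linarith [min_le_left ((∑ x ∈ univ.filter (fun x => s x = some v), p x)) ((∑ x ∈ univ.filter (fun x => s' x = some v), p' x)), e1.2,
          abs_nonneg ((∑ x ∈ univ.filter (fun x => sc' x = some v), p' x) - (∑ x ∈ univ.filter (fun x => s' x = some v), p' x))]
      · rw [min_eq_right h]
        linarith [min_le_right ((∑ x ∈ univ.filter (fun x => s x = some v), p x)) ((∑ x ∈ univ.filter (fun x => s' x = some v), p' x)), e2.2,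
          abs_nonneg ((∑ x ∈ univ.filter (fun x => sc x = some v), p x) - (∑ x ∈ univ.filter (fun x => s x = some v), p x))]
    have h2 := sum_abs_fiberMass_sub_le hp sc s R hR hsc V
    have h3 := sum_abs_fiberMass_sub_le hp' sc' s' R' hR' hsc' V
    linarith
  have hqL0 : 0 ≤ qL := by
    rw [hqL]; exact sum_nonneg fun x _ => mul_nonneg (hp x) (by linarith [(hθ01 (sc x)).2])
  -- assemble
  have hfinal : |(L + T) - (L' + T')| ≤ qL * d + 4 * η := by
    have e : (L + T) - (L' + T') =
        (L - L') + (T - Ts) + (Ts - C) + (C' - Ts') + (Ts' - T') := by rw [hCC']; ring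
    rw [e]
    have a4 : |C' - Ts'| ≤ η := by rw [abs_sub_comm]; exact hTsC'
    have a5 : |Ts' - T'| ≤ η := by rw [abs_sub_comm]; exact hTTs'
    calc |(L - L') + (T - Ts) + (Ts - C) + (C' - Ts') + (Ts' - T')|
        ≤ |L - L'| + |T - Ts| + |Ts - C| + |C' - Ts'| + |Ts' - T'| := by
          refine (abs_add_le _ _).trans ?_
          gcongr
          refine (abs_add_le _ _).trans ?_
          gcongr
          refine (abs_add_le _ _).trans ?_
          gcongr
          exact abs_add_le _ _
      _ ≤ qL * d + η + η + η + η := by gcongr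
      _ = qL * d + 4 * η := by ring
  rw [show (∑ x, p x * (if Φ x ∈ A then 1 else 0)) = ∑ x, p x * χ x from rfl,
    show (∑ x, p' x * (if Φ' x ∈ A then 1 else 0)) = ∑ x, p' x * χ' x from rfl, hdec, hdec']
  calc |L + T - (L' + T')| ≤ qL * d + 4 * η := hfinal
    _ ≤ (1 - c₁ + 4 * η) * d + 4 * η := by gcongr
    _ = 4 * η + (1 - c₁ + 4 * η) * d := by ring

/-! ## Solving the recurrence -/

/-- **The recurrence across scales.** If `D (m) ≤ 1`, `D i ≤ e + θ · D (i+1)` for `i < m`, with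
`0 ≤ θ < 1` and `0 ≤ e`, then `D 0 ≤ θ ^ m + e / (1 - θ)`. [folklore] -/
theorem recurrence_bound (D : ℕ → ℝ) (m : ℕ) {e θ : ℝ} (he : 0 ≤ e) (hθ0 : 0 ≤ θ) (hθ1 : θ < 1)
    (hm : D m ≤ 1) (hstep : ∀ i < m, D i ≤ e + θ * D (i + 1)) :
    D 0 ≤ θ ^ m + e / (1 - θ) := by
  -- `D (m - k) ≤ θ ^ k + e / (1 - θ)` by induction on `k`
  have h1θ : 0 < 1 - θ := by linarith
  have key : ∀ k ≤ m, D (m - k) ≤ θ ^ k + e / (1 - θ) := by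
    intro k
    induction k with
    | zero =>
      intro _
      simp only [Nat.sub_zero, pow_zero]
      have : 0 ≤ e / (1 - θ) := div_nonneg he h1θ.le
      linarith
    | succ k ih =>
      intro hk
      have hk' : k ≤ m := Nat.le_of_succ_le hk
      have hlt : m - (k + 1) < m := by omega
      have heq : m - (k + 1) + 1 = m - k := by omega
      have h := hstep _ hlt
      rw [heq] at h
      have ih' := ih hk'
      calc D (m - (k + 1)) ≤ e + θ * D (m - k) := h
        _ ≤ e + θ * (θ ^ k + e / (1 - θ)) := by gcongr
        _ = θ ^ (k + 1) + e / (1 - θ) := by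
            field_simp
            ring
  simpa using key m le_rfl

end Summit.CriticalPhenomena.SAWScalingLimit.Theorems.ScreeningRecursion.Abstract
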